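import Literature.MathematicalPhysics.QuantumFieldTheory.Balaban1983to89.B8Prop3KLevel
import Literature.MathematicalPhysics.QuantumFieldTheory.Balaban1983to89.B8Thm4KLevelGamma
import Literature.MathematicalPhysics.QuantumFieldTheory.Balaban1983to89.B8LeafModelZd3

/-!
# `Balaban1983to89.B8Prop3KLevelGamma` — [Balaban1985RegularSpaces] **Proposition 3** (p. 87) «(1.40)–(1.42) + (1.61) ⇒ (1.62) with
# B₁ = 5dLB₀» AT `k` LEVELS, EDITION γ — the averaging datum `|B₁|` of (1.56) read over a PARAMETRIC constraint-bond class `Λ` under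
# PRINT's BOX LAW «the box of a level-j datum bond lies in Ω_{j−1}» ((1.31) p. 82 «All sites of the contours Γ_{b₋,x} belong to Λ_{j−1}»;
# [Balaban1984PropagatorsII] (2.3) p. 224), so that the CROSSING bonds of (1.31) are admissible data: n05-b's `B8Prop3KLevel` §1∕§2b
# re-assembled on dag-n05-e's edition-γ (1.56) step `B8Thm4KLevelGamma.norm_B1_lt_kLevel_γ`

statement-level skeleton of published theorems with citation tags; proofs where landed; nothing here is a claim about the Yang–Mills mass gap

T. Bałaban, *Spaces of regular gauge field configurations on a lattice and gauge fixing conditions*, Commun. Math. Phys. **99** (1985) 75–102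
`[Balaban1985RegularSpaces]` ("B8"), (1.31) p. 82, (1.40)–(1.42) p. 83, (1.55)–(1.62) pp. 86–87, Prop. 3 p. 87; [3] = `[Balaban1985Averaging]` Prop. 4
p. 36; [B6] = `[Balaban1984PropagatorsII]` (2.3) p. 224.  PDF held: `paper:balaban1985-cmp99-regular-spaces-gauge-fixing`.  STATUS: published, refereed.

CITATION HEADER (lean-in-tree rule).  Cell `pub-ymgap` (YM Track A, HUMAN RULING D-0062; director-ym №197 ∕ HUMAN RULING D-0149 width push), DAG node
N05 = [B8], WIDTH SEAT `pub-ymgap-dag-n05-w1` (g0); plan g77 W-SEAT-START-LIST v3 §n05 ITEM 1 = (D2) of dag-n05-d g10's D-chain (bus l.23986).  WHY THIS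
FILE.  dag-n05-c's certificates `B8Ineq159FlatShellModeVacuity` (p572834) ∕ `B8SockB9P3ShellModeVacuityUniv` (p576185) show that every (1.59)-type socket whose
averaging datum is read over a class obeying the `ZdIdx` law «box ⊂ Ω_j» (`B8CubeMemberZd.cubeLamB`, `B8IdxB8LawsB.towerBonds` — both WITHOUT print's
level-`j ≥ 1` CROSSING bonds, `B8Ineq159FlatCubeMemberPrinted.towerBonds_inner_of_printTower`) is FALSE at truncation `m ≥ 1` at every nested member (interior
shell gauge modes).  The class of record becomes print's ([B6] (2.3); dag-n05-c `cubeLamBP` p573921, dag-n05-d `towerBondsP`), whose locality box at level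
`j ≥ 1` lies in `Ω_{j−1}`, NOT in `Ω_j` (`B8Ineq159FlatCubeMemberPrinted.cubeLamBP_box_subset_pred`).  n05-b's `B8Prop3KLevel.prop3_norms_kLevel` ∕
`prop3_fifth_kLevel` read the class through ONE lemma, the k-level (1.56) `B8Eq156KLevelLocal.wsup_B1_le_kLevel` under «box ⊂ Ω_j»; dag-n05-e's edition γ of
Theorem 4's driver (`B8Thm4KLevelGamma`, (b′)) supplies the pointwise (1.56) under «box ⊂ Ω_{j−1}» (`norm_B1_lt_kLevel_γ`: [3]-Prop.-4 windows ONE LEVEL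
LOWER, at `(L²α₀, L·α₂)`; remainder constant `8·131072(d+1)²·e^{…L²α₀}·L²`).  THIS FILE is the token-swap re-assembly of n05-b's §1∕§2b on that lemma:
§0 ★ `wsup_B1_le_kLevel_γ` — the k-level `|B₁| ≤ 2dLα₁ + C₂(d, L, α₀)α₂²` over the parametric class under the γ law (`wsup` of `norm_B1_lt_kLevel_γ`);
§1 ★★ `prop3_norms_kLevel_γ` — (1.62) in norm form at `k` levels, `a, g, j₂, l ≤ 5dLB₀(α₀ + α₁)`, n05-b's `prop3_norms_kLevel` VERBATIM except: `hbox` at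
   `Ω (j − 1)` (ℕ subtraction; level `0` unchanged), the (1.56) windows `hα3 hα4 hsmall hc₃` at `(L²α₀, L·α₂)`, the (1.61)-constant hypothesis
   `hC₂ : 8·131072(d+1)²·e^{…L²α₀}·L² ≤ C₂`; (1.55) (`B8Eq155KLevelLocal.eq155_norm_kLevel_hermitian`), the bootstrap `B8.apriori_160` and (1.61) ⇒ (1.62)
   `B8.apriori_162` BY NAME, unchanged;
§2 ★ `prop3_fifth_kLevel_γ` — the Hölder member «B₂(β₀) = 5dLB₀(β₀)» likewise (`B8Prop3Holder.apriori_160_fifth` ∕ `apriori_162_fifth` BY NAME);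
§3 `C2γ_le_of_window` — from the γ window alone the (1.56)-constant is majorised by the `α₀`-free `2097152(d+1)²·L²`; §4 ★ `prop3_windows_γ` — ALL
   windows of §1∕§2 from ONE threshold `c(d, L, B₀)` read at `(L²α₀, L·α₂)` (n05-a's `B8LeafModelZd3.prop3_windows` BY NAME, twice), with the γ
   (1.61)-constant majorised by `2097152(d+1)²·L²` — the shape the univ-road assemblers (`B8LeafModelZd3.prop3Printed_zd3`-type, dag-n05-d's D3) consume.
Consumers (by name): dag-n05-w4's `B8Prop5SocketDatumGamma.grad_bound_of_datum_γ` (INTENT-1 l.24084), dag-n05-d's D3 `prop3Printed_zd3_γ`.  Kind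
«kernel-checked proof», theorems only: no `def`, no `instance`, no `notation`, no existing module modified.

HONEST SCOPE ∕ A6 (director-ym №189 ∕ №196).  Re-assembly by name; nothing of [4] Thm 3.3 or of Propositions 3∕5 beyond print's one-page algebra pp. 86–87 is
proved here.  The four (1.59) lines `h59a h59g h59j h59l` (and the Hölder line `h59h`) are HYPOTHESES read over the PARAMETRIC class `Λ`: their satisfiability
depends on the class supplied — over a «box ⊂ Ω_j» class at a nested member with `k ≥ 1` they are FALSE at `U₀ = 1` (p572834 ∕ p576185); over print's class
(`cubeLamBP` ∕ `cubeLamBP'` ∕ `towerBondsP`) they are print's (1.59) = [4] Thm 3.3 (dag-n05-c's named fact `Ineq159FlatCubeMemberPrinted`, OPEN in the tree;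
inhabited at truncation `m = 0` by dag-n06-b's `B9SupplySockB9P3ZdGamma.Witness.*`; `m ≥ 1` = N06∕N05 content) — no satisfiability claim is made HERE.  As in
n05-b's file: (1.41) and the gradient datum live on `SideTouches (Ω j)`; windows displayed as hypotheses (merely sufficient); `T_η ↦ ℤᵈ`; conclusions `≤` for
print's `<`; `d ≥ 2`, `L ≥ 2`.  Count-neutral; N05 NOT discharged; no count claim; one finite `𝕋⁴` programme at fixed `ε`, Bałaban AS PRINTED; the YM mass gap
(Clay) is NOT proved by any of this — R4 closes the conditional finite-`𝕋⁴` rung `BalabanLadder.UV` only; nothing continuum ∕ ℝ⁴ ∕ OS.  No `sorry`.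
Unit `pub-ymgap-dag-n05-w1` (g0), 2026-08-27.

RELATED IN THE TREE, NOT DUPLICATED: `B8Prop3KLevel` (n05-b; edition «box ⊂ Ω_j»; `bound_of_sideTouches` USED), `B8Thm4KLevelGamma.norm_B1_lt_kLevel_γ`
(dag-n05-e (b′); USED), `B8Eq142KLevelLocalGamma.H42_of_inAx_γ` (dag-n05-e (a′); the (1.42) clause `h42` is supplied by it downstream, not here),
`B8Eq155KLevelLocal.eq155_norm_kLevel_hermitian`, `B8.apriori_160`, `B8.apriori_162`, `B8Prop3Holder.apriori_160_fifth` ∕ `apriori_162_fifth` (USED),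
`B8LeafModelZd3.prop3_windows` (n05-a; USED), `B8Prop3KLevelBdry` (the collar-allowance edition; its γ twin is dag-n05-e's `hP3_gaugeFixed_of_b9_γ`, not this file).
-/

noncomputable section

open scoped BigOperators
open NormedSpace

namespace Literature.MathematicalPhysics.QuantumFieldTheory.Balaban1983to89.B8Prop3KLevelGamma

open B7Prop1Explicit (U1)
open B7Prop1Local (InBox loK bondHiK)
open B7Prop2Explicit (AvgClosed C0 c2' unitaryUnits unitaryUnits_le_U1 avgClosed_unitaryUnits)
open B7Prop3Flat (c3)
open B7Prop4GeneralLevels (logCovIter linCovIter)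
open B8Lemma1NonAbelian (mulCfg)
open B8Ineq132 (covDerivFwd InAk BondTouches)
open B8Eq146AExpansion (iEta expCfg)
open B8Eq155JBound (Jcur wsup wsup_le)
open B8Eq140Level (SideTouches)
open B8ScaledSupNorm (bondNorm msup weight Bdd)
open B8Eq155KLevelLocal (eq155_norm_kLevel_hermitian)
open B8Thm4KLevelGamma (norm_B1_lt_kLevel_γ)
open B8Prop3KLevel (bound_of_sideTouches)

-- `Site` alone would resolve to the torus sites of `Setup.lean`; re-export the `ℤ^d` sites of `B7Prop1Explicit`.
export B7Prop1Explicit (Site)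

variable {d : ℕ} {𝔸 : Type*} [CStarAlgebra 𝔸] [Nontrivial 𝔸]

/-! ## §0 The k-level (1.56) over a parametric class under print's box law «box ⊂ Ω_{j−1}» -/

/-- ★ **(1.56) AT `k` LEVELS, EDITION γ: «|B₁| < 2dLα₁ + C₂α₂²» OVER A PARAMETRIC CONSTRAINT-BOND CLASS `Λ` WHOSE LEVEL-`j` BOXES LIE IN `Ω_{j−1}`** —
n05-a's `B8Eq156KLevelLocal.wsup_B1_le_kLevel` with the law «box ⊂ Ω_j» replaced by print's «box ⊂ Ω_{j−1}» ((1.31): the crossing bonds' contours lie in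
`Λ_{j−1}`; level `0`: `Ω₀`): the weighted supremum `|B₁| = sup_{j ≤ k, c ∈ Λ_j}‖LʲηQ_j(U₀, ηA)(c)‖` (`B8Eq155JBound.wsup` at weight `1` of
`linCovIter L U₀ (iηA)`) is `≤ 2dLα₁ + 8·131072(d+1)²·e^{4c(L²α₀)}·L²·α₂²`, from dag-n05-e's pointwise `norm_B1_lt_kLevel_γ` at every datum bond — the
plaquettes (1.40) and the exponent (1.41) being read on the bond's box one level lower, [3]-Prop.-4 windows at `(L²α₀, L·α₂)`.
[cite: Balaban1985RegularSpaces, (1.56) p.86, (1.31) p.82, (1.40)–(1.42) p.83; Balaban1985Averaging, Prop. 4 p.36; Balaban1984PropagatorsII, (2.3) p.224] -/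
theorem wsup_B1_le_kLevel_γ {η : ℝ} (hη : 0 < η) (L : ℕ) (hL : 2 ≤ L) {G : Subgroup 𝔸ˣ} (hG : AvgClosed d L G) {k : ℕ}
    (U₀ : Site d → Fin d → 𝔸ˣ) (hU₀ : ∀ x κ, U₀ x κ ∈ G) {α₀ : ℝ} (hα₀ : 0 < α₀)
    (hα3 : C0 d * ((L : ℝ) ^ 2 * α₀) ≤ 1 / 3) (hα4 : 4 * ((L : ℝ) ^ 2 * α₀) ≤ c2' d L) (A : Site d → Fin d → 𝔸) {α₂ : ℝ}
    (hα₂ : 0 ≤ α₂)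
    (hsmall : Real.exp (4 * (800 * ((d : ℝ) + 1) ^ 2 * ((d : ℝ) + 4)) * ((L : ℝ) ^ 2 * α₀))
      * (1 + 8 * (131072 * ((d : ℝ) + 1) ^ 2) * ((L : ℝ) * α₂)) ≤ 2)
    (hc₃ : 2 * ((L : ℝ) * α₂) ≤ c3 d L) {Ω : ℕ → Set (Site d)} {Λ : ℕ → Set (Site d × Fin d)}
    (hbox : ∀ j, j ≤ k → ∀ c ∈ Λ j, ∀ x, InBox (loK L j c.1) (bondHiK L j c.1 c.2) x → x ∈ Ω (j - 1))
    (h40 : InAk L k η α₀ Ω U₀)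
    (h41 : ∀ j, j ≤ k → ∀ x μ, BondTouches (Ω j) x μ → ‖A x μ‖ ≤ α₂ * ((L : ℝ) ^ j * η)⁻¹)
    {α₁ : ℝ} (hα₁ : 0 ≤ α₁) (h42 : ∀ j, j ≤ k → ∀ c ∈ Λ j, ‖logCovIter L U₀ (iEta η A) j c.1 c.2‖ < 2 * d * L * α₁) :
    wsup 1 (fun p : {p : ℕ × (Site d × Fin d) // p.1 ≤ k ∧ p.2 ∈ Λ p.1} =>
        linCovIter L U₀ (iEta η A) p.1.1 p.1.2.1 p.1.2.2)
      ≤ 2 * d * L * α₁ + 8 * (131072 * ((d : ℝ) + 1) ^ 2)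
          * Real.exp (4 * (800 * ((d : ℝ) + 1) ^ 2 * ((d : ℝ) + 4)) * ((L : ℝ) ^ 2 * α₀)) * (L : ℝ) ^ 2 * α₂ ^ 2 := by
  have hL' : (0 : ℝ) ≤ (L : ℝ) := Nat.cast_nonneg L
  have hd' : (0 : ℝ) ≤ (d : ℝ) := Nat.cast_nonneg d
  refine wsup_le (fun p => ?_) (by positivity)
  rw [one_mul]
  exact (norm_B1_lt_kLevel_γ hη L hL hG U₀ hU₀ hα₀ hα3 hα4 A hα₂ hsmall hc₃ hbox h40 h41 h42 p.2.1 p.2.2).le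

/-! ## §1 (1.62) in norm form at `k` levels, edition γ -/

/-- ★★ **(1.40)–(1.42) + (1.61) ⇒ (1.62), NORM FORM, AT `k` LEVELS FOR A GENERAL FAMILY `{Ω_j}_{j ≤ k}`, EDITION γ** (pp. 86–87 assembled; `d ≥ 2`) —
n05-b's `B8Prop3KLevel.prop3_norms_kLevel` VERBATIM with the constraint-bond class `Λ` under PRINT's box law «box ⊂ Ω_{j−1}» (`hbox`; (1.31) ∕ [B6] (2.3): inner
AND crossing bonds of `Λ_j`), hence with the (1.56) windows `hα3 hα4 hsmall hc₃` at `(L²α₀, L·α₂)` and the (1.61)-constant `C₂ ≥ C₂(d, L, α₀) =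
8·131072(d+1)²·e^{4c(L²α₀)}·L²` (`hC₂`).  Data: `U₀` unitary-valued, `A` Hermitian (`U₁ = e^{iηA}`).  Hypotheses: (1.40) `U₀, U₁U₀ ∈ 𝔄_k({Ω_j}, α₀)` (`h40₀`,
`h40₁`); (1.41) on `SideTouches (Ω j)`, `j ≤ k` (`h41`); a gradient datum `g ≥ 0` (`hg`); (1.42) `‖Q_j(U₀, ηA)(c)‖ < 2dLα₁` on `Λ_j` (`h42`); «B₀36dα₂ ≦ 1/2»,
`50dα₂ ≤ 1`; (1.61) (`h61`); the four (1.59) bounds of Theorem 3.3 of [4] in the k-level currency `nJ = |J|_(−3)`, `nB = |B₁| = sup_{j ≤ k, c ∈ Λ_j}‖LʲηQ_jA(c)‖`: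
`a, g, j₂, l ≤ B₀(nJ + nB)`.  Conclusion (1.62) with `B₁ = 5dLB₀`: `a, g, j₂, l ≤ 5dLB₀(α₀ + α₁)`.  Proof: (1.55) `eq155_norm_kLevel_hermitian`, (1.56)
`wsup_B1_le_kLevel_γ`, `B8.apriori_160`, `B8.apriori_162` — by name.
[cite: Balaban1985RegularSpaces, Prop. 3 (1.62) p.87, (1.55)–(1.61) p.86, (1.31) p.82, (1.40)–(1.42) p.83; Balaban1984PropagatorsII, (2.3) p.224] -/
theorem prop3_norms_kLevel_γ (hd2 : 2 ≤ d) {η : ℝ} (hη : 0 < η) {L : ℕ} (hL : 2 ≤ L) {k : ℕ}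
    {U₀ : Site d → Fin d → 𝔸ˣ} (hU₀ : ∀ y κ, U₀ y κ ∈ unitaryUnits 𝔸)
    {A : Site d → Fin d → 𝔸} (hAh : ∀ y κ, IsSelfAdjoint (A y κ)) {α₀ α₁ α₂ g : ℝ}
    (hα₀ : 0 < α₀) (hα₁ : 0 ≤ α₁) (hα₂ : 0 ≤ α₂) (hg0 : 0 ≤ g)
    -- [3] Prop. 4's linearisation windows ONE LEVEL LOWER (edition γ: the box of a level-`j` datum bond lies in `Ω_{j−1}`)
    (hα3 : C0 d * ((L : ℝ) ^ 2 * α₀) ≤ 1 / 3) (hα4 : 4 * ((L : ℝ) ^ 2 * α₀) ≤ c2' d L)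
    (h16 : 16 * α₂ ≤ 1) (hd5 : 5 * α₂ * ((d : ℝ) - 1) ≤ 4)
    (hsmall : Real.exp (4 * (800 * ((d : ℝ) + 1) ^ 2 * ((d : ℝ) + 4)) * ((L : ℝ) ^ 2 * α₀))
      * (1 + 8 * (131072 * ((d : ℝ) + 1) ^ 2) * ((L : ℝ) * α₂)) ≤ 2)
    (hc₃ : 2 * ((L : ℝ) * α₂) ≤ c3 d L) {B₀ : ℝ} (hB₀ : 0 ≤ B₀) (hside : 36 * d * B₀ * α₂ ≤ 1 / 2) (h50 : 50 * d * α₂ ≤ 1)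
    {C₂ : ℝ} (hC₂ : 8 * (131072 * ((d : ℝ) + 1) ^ 2) * Real.exp (4 * (800 * ((d : ℝ) + 1) ^ 2 * ((d : ℝ) + 4)) * ((L : ℝ) ^ 2 * α₀))
      * (L : ℝ) ^ 2 ≤ C₂)
    (h61 : 2 * α₂ ^ 2 + 20 * d * α₀ * α₂ + 2 * C₂ * α₂ ^ 2 ≤ α₀ + α₁)
    {Ω : ℕ → Set (Site d)} {Λ : ℕ → Set (Site d × Fin d)}
    -- PRINT's box law (edition γ): the locality box of a level-`j` datum bond lies in `Ω_{j−1}` ((1.31); level 0: `Ω₀`)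
    (hbox : ∀ j, j ≤ k → ∀ c ∈ Λ j, ∀ x, InBox (loK L j c.1) (bondHiK L j c.1 c.2) x → x ∈ Ω (j - 1))
    (h40₀ : InAk L k η α₀ Ω U₀) (h40₁ : InAk L k η α₀ Ω (mulCfg (expCfg (iEta η A)) U₀))
    (h41 : ∀ j, j ≤ k → ∀ y τ, SideTouches (Ω j) y τ → ‖A y τ‖ ≤ α₂ * ((L : ℝ) ^ j * η)⁻¹)
    (hg : ∀ j, j ≤ k → ∀ (y : Site d) (κ τ : Fin d), SideTouches (Ω j) y τ →
      ((L : ℝ) ^ j * η) ^ 2 * ‖covDerivFwd η U₀ κ (fun z => A z τ) y‖ ≤ g)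
    (h42 : ∀ j, j ≤ k → ∀ c ∈ Λ j, ‖logCovIter L U₀ (iEta η A) j c.1 c.2‖ < 2 * d * L * α₁)
    {a j₂ l : ℝ}
    (h59a : a ≤ B₀ * (bondNorm L k η (-(3 : ℝ)) Ω (fun x μ => Jcur η U₀ A μ x)
      + wsup 1 (fun p : {p : ℕ × (Site d × Fin d) // p.1 ≤ k ∧ p.2 ∈ Λ p.1} =>
          linCovIter L U₀ (iEta η A) p.1.1 p.1.2.1 p.1.2.2)))
    (h59g : g ≤ B₀ * (bondNorm L k η (-(3 : ℝ)) Ω (fun x μ => Jcur η U₀ A μ x)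
      + wsup 1 (fun p : {p : ℕ × (Site d × Fin d) // p.1 ≤ k ∧ p.2 ∈ Λ p.1} =>
          linCovIter L U₀ (iEta η A) p.1.1 p.1.2.1 p.1.2.2)))
    (h59j : j₂ ≤ B₀ * (bondNorm L k η (-(3 : ℝ)) Ω (fun x μ => Jcur η U₀ A μ x)
      + wsup 1 (fun p : {p : ℕ × (Site d × Fin d) // p.1 ≤ k ∧ p.2 ∈ Λ p.1} =>
          linCovIter L U₀ (iEta η A) p.1.1 p.1.2.1 p.1.2.2)))
    (h59l : l ≤ B₀ * (bondNorm L k η (-(3 : ℝ)) Ω (fun x μ => Jcur η U₀ A μ x)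
      + wsup 1 (fun p : {p : ℕ × (Site d × Fin d) // p.1 ≤ k ∧ p.2 ∈ Λ p.1} =>
          linCovIter L U₀ (iEta η A) p.1.1 p.1.2.1 p.1.2.2))) :
    a ≤ 5 * d * L * B₀ * (α₀ + α₁) ∧ g ≤ 5 * d * L * B₀ * (α₀ + α₁) ∧
    j₂ ≤ 5 * d * L * B₀ * (α₀ + α₁) ∧ l ≤ 5 * d * L * B₀ * (α₀ + α₁) := by
  have hL1 : 1 ≤ L := le_trans (by norm_num) hL
  have h₀ : ∀ y κ, U₀ y κ ∈ U1 𝔸 := fun y κ => unitaryUnits_le_U1 (hU₀ y κ)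
  -- (1.55) at `k` levels (`B8Eq155KLevelLocal`) — class-independent
  have h55 := eq155_norm_kLevel_hermitian hη hL1 h₀ hAh hα₀.le hα₂ h16 hd5 hg0 h40₀ h40₁ h41 hg
  -- (1.56) at `k` levels under the γ law (§0), with (1.41) moved to the bonds touching `Ω_j`
  have h41' : ∀ j, j ≤ k → ∀ x μ, BondTouches (Ω j) x μ → ‖A x μ‖ ≤ α₂ * ((L : ℝ) ^ j * η)⁻¹ :=
    fun j hj x μ hb => bound_of_sideTouches hd2 (h41 j hj) x μ hb
  have h56 := wsup_B1_le_kLevel_γ hη L hL (avgClosed_unitaryUnits d L) U₀ hU₀ hα₀ hα3 hα4 A hα₂ hsmall hc₃ hbox h40₀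
    h41' hα₁ h42
  -- the bootstrap (1.55) + (1.56) + (1.59) ⇒ (1.60), with `C₂(d, L, α₀)`
  obtain ⟨ha, hg', hj, hl⟩ := B8.apriori_160 (Nat.cast_nonneg d) hB₀ hα₂ hg0 h55 h56 h59a h59g h59j h59l hside h50
  -- `C₂(d, L, α₀) ≤ C₂`, so (1.60) holds with `C₂`
  set R₀ := B₀ * (4 * α₀ + 4 * d * L * α₁ + 2 * α₂ ^ 2 + 20 * d * α₀ * α₂
      + 2 * (8 * (131072 * ((d : ℝ) + 1) ^ 2) * Real.exp (4 * (800 * ((d : ℝ) + 1) ^ 2 * ((d : ℝ) + 4)) * ((L : ℝ) ^ 2 * α₀))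
        * (L : ℝ) ^ 2) * α₂ ^ 2) with hR₀
  set R₁ := B₀ * (4 * α₀ + 4 * d * L * α₁ + 2 * α₂ ^ 2 + 20 * d * α₀ * α₂ + 2 * C₂ * α₂ ^ 2) with hR₁
  have hR : R₀ ≤ R₁ := by
    rw [hR₀, hR₁]
    apply mul_le_mul_of_nonneg_left _ hB₀
    have hsq : 0 ≤ α₂ ^ 2 := sq_nonneg _
    nlinarith [mul_le_mul_of_nonneg_right hC₂ hsq]
  -- (1.60) + (1.61) ⇒ (1.62) (`B8.apriori_162`)
  have hd' : (1 : ℝ) ≤ d := by exact_mod_cast (le_trans (by norm_num) hd2)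
  have hdL : (1 : ℝ) ≤ (d : ℝ) * L := by
    have hL' : (1 : ℝ) ≤ L := by exact_mod_cast hL1
    nlinarith
  have h162 : R₁ ≤ 5 * d * L * B₀ * (α₀ + α₁) := by
    rw [hR₁]
    exact B8.apriori_162 hB₀ hdL hα₀.le hα₁ h61
  exact ⟨ha.trans (hR.trans h162), hg'.trans (hR.trans h162), hj.trans (hR.trans h162), hl.trans (hR.trans h162)⟩

/-! ## §2 The Hölder member «B₂(β₀) = 5dLB₀(β₀)» at `k` levels, edition γ -/

/-- ★ **(1.62), HÖLDER MEMBER, AT `k` LEVELS, EDITION γ** («‖A‖_{1,β} < 5dLB₀(β)(α₀ + α₁)(Lʲη)^{−2−β} on Ω_j», i.e. «B₂(β₀) = 5dLB₀(β₀)») — n05-b's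
`B8Prop3KLevel.prop3_fifth_kLevel` VERBATIM with the class `Λ` under print's box law «box ⊂ Ω_{j−1}» (`hbox`), the (1.56) windows at `(L²α₀, L·α₂)` and the
(1.61)-constant `C₂ ≥ 8·131072(d+1)²·e^{4c(L²α₀)}·L²`: under the hypotheses of `prop3_norms_kLevel_γ` up to and including the gradient line `h59g` (constant
`B₀`), ANY k-level quantity `h` obeying the Hölder line of (1.59) with its own constant `B₀β ≥ 0`, `h ≤ B₀β·(|J|_(−3) + |B₁|)`, satisfies
`h ≤ 5dL·B₀β·(α₀ + α₁)` (`B8Prop3Holder.apriori_160_fifth` ∕ `apriori_162_fifth` BY NAME).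
[cite: Balaban1985RegularSpaces, Prop. 3 (1.62) p.87, (1.36) p.82, (1.59)–(1.61) p.86, (1.31) p.82; Balaban1984PropagatorsII, (2.3) p.224] -/
theorem prop3_fifth_kLevel_γ (hd2 : 2 ≤ d) {η : ℝ} (hη : 0 < η) {L : ℕ} (hL : 2 ≤ L) {k : ℕ}
    {U₀ : Site d → Fin d → 𝔸ˣ} (hU₀ : ∀ y κ, U₀ y κ ∈ unitaryUnits 𝔸)
    {A : Site d → Fin d → 𝔸} (hAh : ∀ y κ, IsSelfAdjoint (A y κ)) {α₀ α₁ α₂ g : ℝ}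
    (hα₀ : 0 < α₀) (hα₁ : 0 ≤ α₁) (hα₂ : 0 ≤ α₂) (hg0 : 0 ≤ g)
    (hα3 : C0 d * ((L : ℝ) ^ 2 * α₀) ≤ 1 / 3) (hα4 : 4 * ((L : ℝ) ^ 2 * α₀) ≤ c2' d L)
    (h16 : 16 * α₂ ≤ 1) (hd5 : 5 * α₂ * ((d : ℝ) - 1) ≤ 4)
    (hsmall : Real.exp (4 * (800 * ((d : ℝ) + 1) ^ 2 * ((d : ℝ) + 4)) * ((L : ℝ) ^ 2 * α₀))
      * (1 + 8 * (131072 * ((d : ℝ) + 1) ^ 2) * ((L : ℝ) * α₂)) ≤ 2)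
    (hc₃ : 2 * ((L : ℝ) * α₂) ≤ c3 d L) {B₀ B₀β : ℝ} (hB₀ : 0 ≤ B₀) (hB₀β : 0 ≤ B₀β) (hside : 36 * d * B₀ * α₂ ≤ 1 / 2)
    (h50 : 50 * d * α₂ ≤ 1)
    {C₂ : ℝ} (hC₂ : 8 * (131072 * ((d : ℝ) + 1) ^ 2) * Real.exp (4 * (800 * ((d : ℝ) + 1) ^ 2 * ((d : ℝ) + 4)) * ((L : ℝ) ^ 2 * α₀))
      * (L : ℝ) ^ 2 ≤ C₂)
    (h61 : 2 * α₂ ^ 2 + 20 * d * α₀ * α₂ + 2 * C₂ * α₂ ^ 2 ≤ α₀ + α₁)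
    {Ω : ℕ → Set (Site d)} {Λ : ℕ → Set (Site d × Fin d)}
    (hbox : ∀ j, j ≤ k → ∀ c ∈ Λ j, ∀ x, InBox (loK L j c.1) (bondHiK L j c.1 c.2) x → x ∈ Ω (j - 1))
    (h40₀ : InAk L k η α₀ Ω U₀) (h40₁ : InAk L k η α₀ Ω (mulCfg (expCfg (iEta η A)) U₀))
    (h41 : ∀ j, j ≤ k → ∀ y τ, SideTouches (Ω j) y τ → ‖A y τ‖ ≤ α₂ * ((L : ℝ) ^ j * η)⁻¹)
    (hg : ∀ j, j ≤ k → ∀ (y : Site d) (κ τ : Fin d), SideTouches (Ω j) y τ →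
      ((L : ℝ) ^ j * η) ^ 2 * ‖covDerivFwd η U₀ κ (fun z => A z τ) y‖ ≤ g)
    (h42 : ∀ j, j ≤ k → ∀ c ∈ Λ j, ‖logCovIter L U₀ (iEta η A) j c.1 c.2‖ < 2 * d * L * α₁)
    {h : ℝ}
    (h59g : g ≤ B₀ * (bondNorm L k η (-(3 : ℝ)) Ω (fun x μ => Jcur η U₀ A μ x)
      + wsup 1 (fun p : {p : ℕ × (Site d × Fin d) // p.1 ≤ k ∧ p.2 ∈ Λ p.1} =>
          linCovIter L U₀ (iEta η A) p.1.1 p.1.2.1 p.1.2.2)))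
    (h59h : h ≤ B₀β * (bondNorm L k η (-(3 : ℝ)) Ω (fun x μ => Jcur η U₀ A μ x)
      + wsup 1 (fun p : {p : ℕ × (Site d × Fin d) // p.1 ≤ k ∧ p.2 ∈ Λ p.1} =>
          linCovIter L U₀ (iEta η A) p.1.1 p.1.2.1 p.1.2.2))) :
    h ≤ 5 * d * L * B₀β * (α₀ + α₁) := by
  have hL1 : 1 ≤ L := le_trans (by norm_num) hL
  have h₀ : ∀ y κ, U₀ y κ ∈ U1 𝔸 := fun y κ => unitaryUnits_le_U1 (hU₀ y κ)
  have h55 := eq155_norm_kLevel_hermitian hη hL1 h₀ hAh hα₀.le hα₂ h16 hd5 hg0 h40₀ h40₁ h41 hg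
  have h41' : ∀ j, j ≤ k → ∀ x μ, BondTouches (Ω j) x μ → ‖A x μ‖ ≤ α₂ * ((L : ℝ) ^ j * η)⁻¹ :=
    fun j hj x μ hb => bound_of_sideTouches hd2 (h41 j hj) x μ hb
  have h56 := wsup_B1_le_kLevel_γ hη L hL (avgClosed_unitaryUnits d L) U₀ hU₀ hα₀ hα3 hα4 A hα₂ hsmall hc₃ hbox h40₀
    h41' hα₁ h42
  have hnB : 0 ≤ wsup 1 (fun p : {p : ℕ × (Site d × Fin d) // p.1 ≤ k ∧ p.2 ∈ Λ p.1} =>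
      linCovIter L U₀ (iEta η A) p.1.1 p.1.2.1 p.1.2.2) := B8Eq155JBound.wsup_nonneg zero_le_one _
  have h160 := B8Prop3Holder.apriori_160_fifth (Nat.cast_nonneg d) hB₀ hB₀β hα₀.le hα₂ hg0 hnB h55 h56 h59g h59h hside h50
  -- `C₂(d, L, α₀) ≤ C₂`
  have h160' : h ≤ B₀β * (4 * α₀ + 4 * d * L * α₁ + 2 * α₂ ^ 2 + 20 * d * α₀ * α₂ + 2 * C₂ * α₂ ^ 2) := by
    refine h160.trans (mul_le_mul_of_nonneg_left ?_ hB₀β)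
    have hsq : 0 ≤ α₂ ^ 2 := sq_nonneg _
    nlinarith [mul_le_mul_of_nonneg_right hC₂ hsq]
  have hd' : (1 : ℝ) ≤ d := by exact_mod_cast (le_trans (by norm_num) hd2)
  have hdL : (1 : ℝ) ≤ (d : ℝ) * L := by
    have hL' : (1 : ℝ) ≤ L := by exact_mod_cast hL1
    nlinarith
  exact B8Prop3Holder.apriori_162_fifth hB₀β hdL hα₀.le hα₁ h61 h160'

/-! ## §3 The γ (1.56)-constant is majorised by the `α₀`-free `2097152(d+1)²·L²` -/

omit [Nontrivial 𝔸] in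
/-- From the γ window `e^{4c(L²α₀)}(1 + 8C₁(Lα₂)) ≤ 2` alone: `e^{4c(L²α₀)} ≤ 2`, hence the edition-γ (1.56)-constant
`C₂(d, L, α₀) = 8C₁e^{4c(L²α₀)}·L²` is majorised by the `α₀`-free `C₂(d, L) = 16C₁L² = 2097152(d+1)²·L²` — the shape in which one-threshold assemblers
(`B8Prop3KLevel.prop3_kLevel`, `B8LeafModelZd3.prop3_windows`) state (1.61). [cite: Balaban1985RegularSpaces, (1.56) p.86, (1.61) p.87; Balaban1985Averaging, Prop. 4 p.36] -/
theorem C2γ_le_of_window {L : ℕ} {α₀ α₂ : ℝ} (hLα₂ : 0 ≤ (L : ℝ) * α₂)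
    (hsmall : Real.exp (4 * (800 * ((d : ℝ) + 1) ^ 2 * ((d : ℝ) + 4)) * ((L : ℝ) ^ 2 * α₀))
      * (1 + 8 * (131072 * ((d : ℝ) + 1) ^ 2) * ((L : ℝ) * α₂)) ≤ 2) :
    8 * (131072 * ((d : ℝ) + 1) ^ 2) * Real.exp (4 * (800 * ((d : ℝ) + 1) ^ 2 * ((d : ℝ) + 4)) * ((L : ℝ) ^ 2 * α₀)) * (L : ℝ) ^ 2
      ≤ 2097152 * ((d : ℝ) + 1) ^ 2 * (L : ℝ) ^ 2 := by
  set E := Real.exp (4 * (800 * ((d : ℝ) + 1) ^ 2 * ((d : ℝ) + 4)) * ((L : ℝ) ^ 2 * α₀)) with hE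
  have hE0 : 0 < E := Real.exp_pos _
  have hy : 0 ≤ 8 * (131072 * ((d : ℝ) + 1) ^ 2) * ((L : ℝ) * α₂) := by positivity
  have hE2 : E ≤ 2 := by nlinarith
  have hK : 0 ≤ 8 * (131072 * ((d : ℝ) + 1) ^ 2) * (L : ℝ) ^ 2 := by positivity
  calc 8 * (131072 * ((d : ℝ) + 1) ^ 2) * E * (L : ℝ) ^ 2 = 8 * (131072 * ((d : ℝ) + 1) ^ 2) * (L : ℝ) ^ 2 * E := by ring
    _ ≤ 8 * (131072 * ((d : ℝ) + 1) ^ 2) * (L : ℝ) ^ 2 * 2 := mul_le_mul_of_nonneg_left hE2 hK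
    _ = 2097152 * ((d : ℝ) + 1) ^ 2 * (L : ℝ) ^ 2 := by ring

/-! ## §4 All windows of the γ edition from ONE threshold read at `(L²α₀, L·α₂)` -/

omit [Nontrivial 𝔸] in
/-- ★ **PROPOSITION 3's WINDOWS, EDITION γ, FROM ONE THRESHOLD** `c = c(d, L, B₀) > 0` (the threshold of n05-a's `B8LeafModelZd3.prop3_windows` = n05-b's
`B8Prop3KLevel.prop3_kLevel`): for `0 < α₀` with `L²α₀ ≤ c` and `0 ≤ α₂` with `L·α₂ ≤ c`, the eight windows of `prop3_norms_kLevel_γ` ∕ `prop3_fifth_kLevel_γ`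
hold — the (1.56) windows at `(L²α₀, L·α₂)`, the (1.55) ∕ bootstrap windows at `α₂` — and the γ (1.56)-constant is majorised by the `α₀`-free `2097152(d+1)²·L²`
(so (1.61) may be stated with `C₂ = 2097152(d+1)²·L²`).  Print: «α₀, α₁, α₂ bounded by a constant depending on d and L only».  `prop3_windows` BY NAME at
`(L²α₀, L·α₂)`, and `α₂ ≤ L·α₂` (`L ≥ 1`). [cite: Balaban1985RegularSpaces, Prop. 3 p.87, (1.61) p.87, (1.31) p.82] -/
theorem prop3_windows_γ (hd2 : 2 ≤ d) {L : ℕ} (hL : 2 ≤ L) {B₀ : ℝ} (hB₀ : 0 ≤ B₀) :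
    ∃ c : ℝ, 0 < c ∧ ∀ α₀ α₂ : ℝ, 0 < α₀ → (L : ℝ) ^ 2 * α₀ ≤ c → 0 ≤ α₂ → (L : ℝ) * α₂ ≤ c →
      C0 d * ((L : ℝ) ^ 2 * α₀) ≤ 1 / 3 ∧ 4 * ((L : ℝ) ^ 2 * α₀) ≤ c2' d L ∧ 16 * α₂ ≤ 1 ∧ 5 * α₂ * ((d : ℝ) - 1) ≤ 4 ∧
      Real.exp (4 * (800 * ((d : ℝ) + 1) ^ 2 * ((d : ℝ) + 4)) * ((L : ℝ) ^ 2 * α₀))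
        * (1 + 8 * (131072 * ((d : ℝ) + 1) ^ 2) * ((L : ℝ) * α₂)) ≤ 2 ∧
      2 * ((L : ℝ) * α₂) ≤ c3 d L ∧ 36 * d * B₀ * α₂ ≤ 1 / 2 ∧ 50 * d * α₂ ≤ 1 ∧
      8 * (131072 * ((d : ℝ) + 1) ^ 2) * Real.exp (4 * (800 * ((d : ℝ) + 1) ^ 2 * ((d : ℝ) + 4)) * ((L : ℝ) ^ 2 * α₀)) * (L : ℝ) ^ 2
        ≤ 2097152 * ((d : ℝ) + 1) ^ 2 * (L : ℝ) ^ 2 := by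
  obtain ⟨c, hc, H⟩ := B8LeafModelZd3.prop3_windows hd2 hL hB₀
  refine ⟨c, hc, fun α₀ α₂ hα₀ hα₀c hα₂ hα₂c => ?_⟩
  have hL1 : (1 : ℝ) ≤ L := by exact_mod_cast (le_trans (by norm_num) hL : 1 ≤ L)
  have hd1 : (1 : ℝ) ≤ d := by exact_mod_cast (le_trans (by norm_num) hd2 : 1 ≤ d)
  have hLα₀ : 0 < (L : ℝ) ^ 2 * α₀ := by positivity
  have hLα₂ : 0 ≤ (L : ℝ) * α₂ := by positivity
  -- the windows at the scaled pair `(L²α₀, L·α₂)`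
  obtain ⟨hα3, hα4, h16', hd5', hsmall, hc₃, hside', h50', hC⟩ := H _ _ hLα₀ hα₀c hLα₂ hα₂c
  -- `α₂ ≤ L·α₂`
  have hle : α₂ ≤ (L : ℝ) * α₂ := by nlinarith
  have h16 : 16 * α₂ ≤ 1 := by linarith
  have hd5 : 5 * α₂ * ((d : ℝ) - 1) ≤ 4 := by nlinarith
  have hside : 36 * d * B₀ * α₂ ≤ 1 / 2 := by
    have : 36 * d * B₀ * α₂ ≤ 36 * d * B₀ * ((L : ℝ) * α₂) := mul_le_mul_of_nonneg_left hle (by positivity)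
    linarith
  have h50 : 50 * d * α₂ ≤ 1 := by nlinarith
  have hL2 : 0 ≤ (L : ℝ) ^ 2 := by positivity
  exact ⟨hα3, hα4, h16, hd5, hsmall, hc₃, hside, h50, by nlinarith [mul_le_mul_of_nonneg_right hC hL2]⟩

#print axioms wsup_B1_le_kLevel_γ
#print axioms prop3_norms_kLevel_γ
#print axioms prop3_fifth_kLevel_γ
#print axioms C2γ_le_of_window
#print axioms prop3_windows_γ

/-! ## §5 (v1.1, APPEND-ONLY) Proposition 3 at `k` levels in print's quantifier shape, edition γ: one threshold `c(d, L, B₀)`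

v1.1 (same unit, same day; the 310 lines above byte-identical): n05-b's `B8Prop3KLevel.prop3_kLevel` — PROPOSITION 3 in print's quantifier shape «α₀, α₁, α₂
bounded by a constant depending on d and L only» — EDITION γ, the member-generic ∃c-form a carrier instance (dag-n05-d's D3 on the P-carrier, or any family
reading (1.42) over print's class) wraps per member. -/

/-- ★ **PROPOSITION 3 (p. 87) AT `k` LEVELS FOR A GENERAL FAMILY `{Ω_j}_{j ≤ k}` AND A GENERAL UNITARY BACKGROUND, IN PRINT's QUANTIFIER SHAPE, EDITION γ** —
n05-b's `B8Prop3KLevel.prop3_kLevel` VERBATIM in binder order and names, with the constraint-bond class `Λ` under PRINT's box law «box ⊂ Ω_{j−1}» ((1.31) ∕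
[B6] (2.3)) and (1.61) stated with the `α₀`-free γ constant `C₂ = 2097152(d+1)²·L²` (§3∕§4): there is ONE threshold `c = c(d, L, B₀) > 0` (n05-b's
`c(d, L, B₀)` divided by `L²`, so that `α₀ ≤ c`, `α₂ ≤ c` put `(L²α₀, L·α₂)` below n05-b's threshold — the (1.56) windows of the γ law, `prop3_windows_γ`)
such that for all `0 < α₀, α₁, α₂ ≤ c` with (1.61), every unitary-valued `U₀`, Hermitian `A`, site domains `Ω` and constraint bonds `Λ` (boxes of level `j`
in `Ω_{j−1}`) satisfying the LEVEL-WISE (1.40)–(1.42), every gradient datum `g ≥ 0` and the four (1.59) bounds of Theorem 3.3 of [4] in the k-level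
currency: (1.62) with `B₁ = 5dLB₀` in norm form, `a, g, j₂, l ≤ 5dLB₀(α₀ + α₁)`, and the first member pointwise AS PRINTED when `a = |A|_(−1)`:
`‖A(b)‖ ≤ 5dLB₀(α₀ + α₁)(Lʲη)⁻¹` for every bond `b` touching `Ω_j`, `j ≤ k` (`prop3_norms_kLevel_γ` + n05-b's `prop3_pointwise_A_kLevel` BY NAME).
[cite: Balaban1985RegularSpaces, Prop. 3 p.87, (1.31) p.82, (1.40)–(1.42) p.83, (1.59)–(1.62) pp.86–87; Balaban1984PropagatorsII, (2.3) p.224] -/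
theorem prop3_kLevel_γ (hd2 : 2 ≤ d) {η : ℝ} (hη : 0 < η) {L : ℕ} (hL : 2 ≤ L) (k : ℕ) {B₀ : ℝ} (hB₀ : 0 ≤ B₀) :
    ∃ c : ℝ, 0 < c ∧ ∀ ⦃α₀ α₁ α₂ : ℝ⦄, 0 < α₀ → α₀ ≤ c → 0 < α₁ → α₁ ≤ c → 0 < α₂ → α₂ ≤ c →
      2 * α₂ ^ 2 + 20 * d * α₀ * α₂ + 2 * (2097152 * ((d : ℝ) + 1) ^ 2 * (L : ℝ) ^ 2) * α₂ ^ 2 ≤ α₀ + α₁ →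
      ∀ (U₀ : Site d → Fin d → 𝔸ˣ), (∀ y κ, U₀ y κ ∈ unitaryUnits 𝔸) →
      ∀ (A : Site d → Fin d → 𝔸), (∀ y κ, IsSelfAdjoint (A y κ)) →
      ∀ (Ω : ℕ → Set (Site d)) (Λ : ℕ → Set (Site d × Fin d)),
      (∀ j, j ≤ k → ∀ c ∈ Λ j, ∀ x, InBox (loK L j c.1) (bondHiK L j c.1 c.2) x → x ∈ Ω (j - 1)) →
      InAk L k η α₀ Ω U₀ → InAk L k η α₀ Ω (mulCfg (expCfg (iEta η A)) U₀) →
      (∀ j, j ≤ k → ∀ y τ, SideTouches (Ω j) y τ → ‖A y τ‖ ≤ α₂ * ((L : ℝ) ^ j * η)⁻¹) →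
      (∀ j, j ≤ k → ∀ c ∈ Λ j, ‖logCovIter L U₀ (iEta η A) j c.1 c.2‖ < 2 * d * L * α₁) →
      ∀ ⦃g : ℝ⦄, 0 ≤ g →
      (∀ j, j ≤ k → ∀ (y : Site d) (κ τ : Fin d), SideTouches (Ω j) y τ →
        ((L : ℝ) ^ j * η) ^ 2 * ‖covDerivFwd η U₀ κ (fun z => A z τ) y‖ ≤ g) →
      ∀ ⦃a j₂ l : ℝ⦄,
      a ≤ B₀ * (bondNorm L k η (-(3 : ℝ)) Ω (fun x μ => Jcur η U₀ A μ x)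
        + wsup 1 (fun p : {p : ℕ × (Site d × Fin d) // p.1 ≤ k ∧ p.2 ∈ Λ p.1} =>
            linCovIter L U₀ (iEta η A) p.1.1 p.1.2.1 p.1.2.2)) →
      g ≤ B₀ * (bondNorm L k η (-(3 : ℝ)) Ω (fun x μ => Jcur η U₀ A μ x)
        + wsup 1 (fun p : {p : ℕ × (Site d × Fin d) // p.1 ≤ k ∧ p.2 ∈ Λ p.1} =>
            linCovIter L U₀ (iEta η A) p.1.1 p.1.2.1 p.1.2.2)) →
      j₂ ≤ B₀ * (bondNorm L k η (-(3 : ℝ)) Ω (fun x μ => Jcur η U₀ A μ x)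
        + wsup 1 (fun p : {p : ℕ × (Site d × Fin d) // p.1 ≤ k ∧ p.2 ∈ Λ p.1} =>
            linCovIter L U₀ (iEta η A) p.1.1 p.1.2.1 p.1.2.2)) →
      l ≤ B₀ * (bondNorm L k η (-(3 : ℝ)) Ω (fun x μ => Jcur η U₀ A μ x)
        + wsup 1 (fun p : {p : ℕ × (Site d × Fin d) // p.1 ≤ k ∧ p.2 ∈ Λ p.1} =>
            linCovIter L U₀ (iEta η A) p.1.1 p.1.2.1 p.1.2.2)) →
      (a ≤ 5 * d * L * B₀ * (α₀ + α₁) ∧ g ≤ 5 * d * L * B₀ * (α₀ + α₁) ∧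
        j₂ ≤ 5 * d * L * B₀ * (α₀ + α₁) ∧ l ≤ 5 * d * L * B₀ * (α₀ + α₁)) ∧
      (a = bondNorm L k η (-(1 : ℝ)) Ω A →
        ∀ j, j ≤ k → ∀ x μ, BondTouches (Ω j) x μ → ‖A x μ‖ ≤ 5 * d * L * B₀ * (α₀ + α₁) * ((L : ℝ) ^ j * η)⁻¹) := by
  have hL1 : 1 ≤ L := le_trans (by norm_num) hL
  have hLr : (1 : ℝ) ≤ L := by exact_mod_cast hL1
  have hL2 : (1 : ℝ) ≤ (L : ℝ) ^ 2 := one_le_pow₀ hLr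
  have hL20 : (0 : ℝ) < (L : ℝ) ^ 2 := by positivity
  obtain ⟨c, hc, hwin⟩ := prop3_windows_γ (d := d) hd2 hL hB₀
  refine ⟨c / (L : ℝ) ^ 2, div_pos hc hL20, ?_⟩
  intro α₀ α₁ α₂ hα₀ hα₀c hα₁ hα₁c hα₂ hα₂c h61 U₀ hU₀ A hAh Ω Λ hbox h40₀ h40₁ h41 h42 g hg0 hg a j₂ l
    h59a h59g h59j h59l
  -- `α₀ ≤ c/L²` and `α₂ ≤ c/L²` put `(L²α₀, L·α₂)` below n05-b's threshold `c`
  have hα₀' : (L : ℝ) ^ 2 * α₀ ≤ c := by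
    have h := mul_le_mul_of_nonneg_left hα₀c hL20.le
    rwa [mul_div_cancel₀ _ hL20.ne'] at h
  have hα₂' : (L : ℝ) * α₂ ≤ c := by
    have hLL : (L : ℝ) ≤ (L : ℝ) ^ 2 := by rw [sq]; exact le_mul_of_one_le_right (by positivity) hLr
    have h1 : (L : ℝ) * α₂ ≤ (L : ℝ) ^ 2 * α₂ := mul_le_mul_of_nonneg_right hLL hα₂.le
    have h2 := mul_le_mul_of_nonneg_left hα₂c hL20.le
    rw [mul_div_cancel₀ _ hL20.ne'] at h2
    exact h1.trans h2
  obtain ⟨hα3, hα4, h16, hd5, hsmall, hc₃, hside, h50, hC⟩ := hwin α₀ α₂ hα₀ hα₀' hα₂.le hα₂'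
  have hN := prop3_norms_kLevel_γ hd2 hη hL hU₀ hAh hα₀ hα₁.le hα₂.le hg0 hα3 hα4 h16 hd5 hsmall hc₃ hB₀ hside h50 hC
    h61 hbox h40₀ h40₁ h41 hg h42 h59a h59g h59j h59l
  refine ⟨hN, fun ha j hj x μ hb => ?_⟩
  have hA : bondNorm L k η (-(1 : ℝ)) Ω A ≤ 5 * d * L * B₀ * (α₀ + α₁) := by rw [← ha]; exact hN.1
  exact B8Prop3KLevel.prop3_pointwise_A_kLevel hd2 hη hL1 h41 hA hj hb

#print axioms prop3_kLevel_γ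

end Literature.MathematicalPhysics.QuantumFieldTheory.Balaban1983to89.B8Prop3KLevelGamma

end
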